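import Literature.Probability.LatticeModels.LatticeSineGordon
import Summits.QuantumFields.YangMills.Theorems.SmallCircleAnchorAnchorGapStubDebyeScreening2

/-!
# Crux `AnchorGap` (stmt-QuantumFields-11141), line `registered` — translation of Gaussian integrals (step M-b toolkit under stub DSred)

Brydges' translation step `φ = ψ + g(h)` ((3.3)–(3.8) of Comm. Math. Phys. 58 (1978) 313, §3) for the
Debye–Hückel reference Gaussian of `…StubDebyeScreening11`: for a symmetric precision matrix `P` and
any shift `h`,

  `∫ F(φ + h) e^{−½ φᵀPφ} dφ = ∫ F(φ) e^{hᵀPφ − ½ hᵀPh} e^{−½ φᵀPφ} dφ`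

(`dhGaussian_translate`; no integrability hypothesis: both sides are Bochner integrals of translates,
`integral_comp_add_const`), with the quadratic-form expansion `(φ − h)ᵀP(φ − h) = φᵀPφ − 2hᵀPφ + hᵀPh`
(`quadForm_sub_eq`).  This is the finite-dimensional Cameron–Martin formula used to move the sector
minimum `h` into a linear source.
-/

set_option autoImplicit false

noncomputable section

namespace Summit.QuantumFields.YangMills.Theorems.AnchorGap

open MeasureTheory Finset Matrix
open Literature.Probability.LatticeModels

/-- **Expansion of a symmetric quadratic form under translation**:
`(φ − h)ᵀP(φ − h) = φᵀPφ − 2 hᵀPφ + hᵀPh` for `Pᵀ = P`. [folklore] -/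
theorem quadForm_sub_eq :
    ∀ (ι : Type) [Fintype ι] (P : Matrix ι ι ℝ), P.IsSymm → ∀ (φ h : ι → ℝ), (φ - h) ⬝ᵥ (P *ᵥ (φ - h)) = φ ⬝ᵥ (P *ᵥ φ) - 2 * (h ⬝ᵥ (P *ᵥ φ)) + h ⬝ᵥ (P *ᵥ h) := by
  intro ι _ P hP φ h
  have hsymm : ∀ u v : ι → ℝ, u ⬝ᵥ (P *ᵥ v) = v ⬝ᵥ (P *ᵥ u) := fun u v => by
    rw [Matrix.dotProduct_mulVec, ← Matrix.mulVec_transpose, hP.eq, dotProduct_comm]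
  rw [Matrix.mulVec_sub, sub_dotProduct, dotProduct_sub, dotProduct_sub, hsymm φ h]
  ring

/-- **Translation of Debye–Hückel Gaussian integrals (finite-dimensional Cameron–Martin).** For a
symmetric precision matrix `P` on `(ℤ/N)^d × Fin k`, every shift `h` and every `F`,
`∫ F(φ + h) e^{−½φᵀPφ} dφ = ∫ F(φ) e^{hᵀPφ − ½hᵀPh} e^{−½φᵀPφ} dφ` (Lebesgue measure on configurations
is translation invariant, `integral_comp_add_const`; then `quadForm_sub_eq`). [folklore] -/
theorem dhGaussian_translate :
    ∀ (d N k : ℕ) [NeZero N] (P : Matrix (TorusSite d N × Fin k) (TorusSite d N × Fin k) ℝ), P.IsSymm → ∀ (h : LatticeSineGordon.Config d N k) (F : LatticeSineGordon.Config d N k → ℝ), ∫ φ : LatticeSineGordon.Config d N k, F (fun p => φ p + h p) * Real.exp (-(φ ⬝ᵥ (P *ᵥ φ)) / 2) = ∫ φ : LatticeSineGordon.Config d N k, F φ * (Real.exp (h ⬝ᵥ (P *ᵥ φ) - (h ⬝ᵥ (P *ᵥ h)) / 2) * Real.exp (-(φ ⬝ᵥ (P *ᵥ φ)) / 2)) :=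 by
  intro d N k _ P hP h F
  have key := integral_comp_add_const d N k h
    (fun ψ => F ψ * Real.exp (-((ψ - h) ⬝ᵥ (P *ᵥ (ψ - h))) / 2))
  have hL : ∀ φ : LatticeSineGordon.Config d N k,
      (fun ψ => F ψ * Real.exp (-((ψ - h) ⬝ᵥ (P *ᵥ (ψ - h))) / 2)) (fun p => φ p + h p) =
        F (fun p => φ p + h p) * Real.exp (-(φ ⬝ᵥ (P *ᵥ φ)) / 2) := by
    intro φ
    have : (fun p => φ p + h p) - h = φ := by funext p; simp
    simp only [this]
  simp_rw [hL] at key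
  rw [key]
  refine integral_congr_ae (Filter.Eventually.of_forall fun φ => ?_)
  simp only []
  rw [quadForm_sub_eq _ P hP φ h, ← Real.exp_add]
  congr 1
  ring_nf

end Summit.QuantumFields.YangMills.Theorems.AnchorGap

end
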